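import Summits.NavierStokesRegularity.NavierStokesRegularity.Theorems.StretchingWellBindingEnstrophyQuarterLawRegisteredStatus
import Summits.NavierStokesRegularity.NavierStokesRegularity.Theorems.StretchingWellBindingEnstrophyQuarterLawEnvelopeSparseness
import HarnessLib

/-!
# Shelf crux `EnstrophyQuarterLaw` (stmt-NavierStokesRegularity-1574), line «sparse_sieve», REGISTERED VOCABULARY:
# stub S2 from multi-scar envelopes of arbitrary rate, and the crux from stub 6 + envelopes, BY NAME

Sequel to `…EnstrophyQuarterLawRegisteredStatus` (p817733: `EnstrophyQuarterLaw ⟺ stub_noTypeII ∧ (∀ first blow-ups, S2)`)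
and `…EnstrophyQuarterLawEnvelopeSparseness` (p819768: an any-rate multi-scar envelope gives `UniformSparseness T u`).
`--supports stmt-NavierStokesRegularity-1574 --as helper`.

* `stub_uniformSparseness_of_envelopes` — if every first blow-up (maximal classical, Leray–Hopf, rapidly decaying datum)
  admits a multi-scar envelope `‖u(t,x)‖ ≤ C' + Σ_{a∈σ} C'/(‖x−a‖ + ℓ(t))` with `σ` finite and `ℓ > 0` of ANY rate, then the
  REGISTERED signature of `stub_uniformSparseness` holds verbatim (S2 is type-blind: the rate `ℓ` is not used beyond `ℓ > 0`);
* `enstrophyQuarterLaw_of_stub_noTypeII_of_envelopes` — hence, BY NAME, `stub_noTypeII` (stmt-0056) and any-rate envelopes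
  at every first blow-up give the crux `EnstrophyQuarterLaw` (through p817733).

READING. In the factorisation `EQL ⟺ 0056 ∧ S2∀` the second factor is discharged by "finitely many scars, no satellites" at
ANY rate; all rate information sits in 0056. (For Type-I-RATE envelopes the quarter law is TIQG's landed `EnvelopeQuarterLaw`,
stmt-23844, directly.) HONEST FRAMING: implications between OPEN / hypothetical statements; `EnstrophyQuarterLaw` (1574), 0056,
S2 and Navier–Stokes regularity stay OPEN; no summit statement is proved.
-/

noncomputable section

-- the summit and its single sub-problem share the name (CONVENTIONS §1), as in every Theorems file
set_option linter.dupNamespace false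

namespace Summit.NavierStokesRegularity.NavierStokesRegularity.Theorems.EnstrophyQuarterLaw.SparseSieve.Registered

open MeasureTheory Set Metric
open Literature.Analysis Literature.Analysis.FluidPDE
open scoped ENNReal

/-- **Registered stub S2 from any-rate multi-scar envelopes.** If every first blow-up admits a finite set of scars `σ`,
a constant `C' ≥ 0` and a positive rate function `ℓ` on `[0,T)` with `‖u(t,x)‖ ≤ C' + Σ_{a∈σ} C'/(‖x−a‖ + ℓ(t))`, then the
registered signature of `stub_uniformSparseness` holds (`EnvelopeSparseness.uniformSparseness_of_envelope_lerayHopf` at each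
solution). Conditional on a hypothetical envelope; nothing is asserted. [folklore] -/
theorem stub_uniformSparseness_of_envelopes
    (henv : ∀ (ν T : ℝ), 0 < ν → 0 < T →
      ∀ (u : ℝ → EuclideanSpace ℝ (Fin 3) → EuclideanSpace ℝ (Fin 3))
        (p : ℝ → EuclideanSpace ℝ (Fin 3) → ℝ),
      IsMaximalSmoothSolution ν 0 u p T → IsLerayHopfOn T ν 0 (u 0) u →
      HasRapidSpatialDecay (u 0) →
      ∃ (σ : Finset (EuclideanSpace ℝ (Fin 3))) (C' : ℝ) (ℓ : ℝ → ℝ), 0 ≤ C' ∧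
        (∀ t ∈ Ico 0 T, 0 < ℓ t) ∧
        ∀ t ∈ Ico 0 T, ∀ x, ‖u t x‖ ≤ C' + ∑ a ∈ σ, C' / (‖x - a‖ + ℓ t)) :
    ∀ (ν T : ℝ), 0 < ν → 0 < T →
      ∀ (u : ℝ → EuclideanSpace ℝ (Fin 3) → EuclideanSpace ℝ (Fin 3))
        (p : ℝ → EuclideanSpace ℝ (Fin 3) → ℝ),
      IsMaximalSmoothSolution ν 0 u p T → IsLerayHopfOn T ν 0 (u 0) u →
      HasRapidSpatialDecay (u 0) → UniformSparseness T u := by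
  intro ν T hν hT u p hmax hLH hdec
  obtain ⟨σ, C', ℓ, hC', hℓ, h⟩ := henv ν T hν hT u p hmax hLH hdec
  exact EnvelopeSparseness.uniformSparseness_of_envelope_lerayHopf hν hLH σ hC' ℓ hℓ h

/-- **The crux from stub 6 and any-rate envelopes, BY NAME:** `TypeIliouvilleNoTypeII` (stmt-0056, registered stub
`stub_noTypeII`) together with an any-rate multi-scar envelope at every first blow-up implies
`StretchingWellBinding.EnstrophyQuarterLaw` (stmt-1574), through the registered-vocabulary status
`enstrophyQuarterLaw_iff_stub_noTypeII_and_stub_uniformSparseness` (p817733). Conditional on OPEN / hypothetical statements;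
no summit statement is proved. [folklore] -/
theorem enstrophyQuarterLaw_of_stub_noTypeII_of_envelopes
    (hS6 : Summit.NavierStokesRegularity.NavierStokesRegularity.Theses.TypeILiouville.TypeIliouvilleNoTypeII)
    (henv : ∀ (ν T : ℝ), 0 < ν → 0 < T →
      ∀ (u : ℝ → EuclideanSpace ℝ (Fin 3) → EuclideanSpace ℝ (Fin 3))
        (p : ℝ → EuclideanSpace ℝ (Fin 3) → ℝ),
      IsMaximalSmoothSolution ν 0 u p T → IsLerayHopfOn T ν 0 (u 0) u →
      HasRapidSpatialDecay (u 0) →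
      ∃ (σ : Finset (EuclideanSpace ℝ (Fin 3))) (C' : ℝ) (ℓ : ℝ → ℝ), 0 ≤ C' ∧
        (∀ t ∈ Ico 0 T, 0 < ℓ t) ∧
        ∀ t ∈ Ico 0 T, ∀ x, ‖u t x‖ ≤ C' + ∑ a ∈ σ, C' / (‖x - a‖ + ℓ t)) :
    Summit.NavierStokesRegularity.NavierStokesRegularity.Theses.StretchingWellBinding.EnstrophyQuarterLaw :=
  enstrophyQuarterLaw_iff_stub_noTypeII_and_stub_uniformSparseness.2
    ⟨hS6, stub_uniformSparseness_of_envelopes henv⟩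

end Summit.NavierStokesRegularity.NavierStokesRegularity.Theorems.EnstrophyQuarterLaw.SparseSieve.Registered

end
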